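import Summits.QuantumFields.YangMills.Theorems.BalabanUVNodesN15FullPropagatorMatrixTwoSidedNode
import Summits.QuantumFields.YangMills.Theorems.BalabanUVNodesN15BackgroundV1MeanGaugeLetters
import Summits.QuantumFields.YangMills.Theorems.BalabanUVNodesN15VectorPieceV1Coarse
import HarnessLib

/-!
# `T4EtaRate.NE2PlusOperator` BY NAME FOR BAŁABAN's FULL `U ≡ 1` PROPAGATOR ⊗ 1_𝔤 ON THE TORUS FAMILY DRESSED BY HIS OWN FIRST-ORDER SPECIES `V′₁(A)` (3.52) OF A LIVE GAUGE FIELD — fine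
# coefficients from the fine field `A′`, COARSE coefficients from the BLOCK-MEAN field `Ā = gavgM π A′`, both bond orientations, entry 2 by parts, NO (3.44) mixed letter
# (dag-n15-c g9, FILE 27; Track-A node N15 = NE2, s1 «background-layer OPERATOR ingredient»)

`--kind definition --supports stmt-QuantumFields-20544 --as helper` (K3⁷; count-neutral).  Imports BY NAME this seat's FILE 21 `…FullPropagatorMatrixTwoSidedNode` (`dPiecesM₂`, ★★
`uniform_layer_fullGM₂`; through it FILE 15 ★★ `hasMaj_shiftDefect_fullGM`, FILE 12 `hasMaj_mmulOp_translate` ∕ `hasMaj_mmulOp_sub_translate` ∕ `pull_comp_mmulOp_translate`, part 71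
`hasMaj_twoGridDefect_div`, FILE 4 `symbOp_sTinv_sub_one_eq`, FILE 8 `le_rate`), FILE 26 `…BackgroundV1MeanGaugeLetters` (★★★ `twoSidedLetters_of_meanGauge`; through it FILE 24 ★★★
`ne2PlusOperator_twoSided_of_letters`, `bgInstanceM₂R`, `bgFamilyM₂R`, `TwoSidedLetters.mono`, g3 `v1GaugeBg` ∕ `v1GaugePairing` ∕ `reg335_v1GaugeBg_iff`, g1 `gavgM`, g2 `v1coefC` ∕ `v1coefA` ∕
`v1fieldsOfGauge`), -a ∕ g3 ∕ g4 torus laws (`kingPrV_bshiftEquiv_pow`, `fibre_conn_kingPrV`, `bshiftEquiv_comm`, `inv_pow_le_rpow`); nothing in the tree is modified.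

WHAT.  §1 `v1cfgF`, `v1cfgC` (defs: the coefficient READINGS `A′ ↦ (c′, a′)(A′)` at the fine spacing and `A′ ↦ (c, a)(Ā)` at the coarse spacing), `fgInstanceV1G` (def; = g3's `v1GaugeInstance` on the
two-grid torus family of record, `fgInstanceV1G_eq`), `fgFamilyV1G` (def: FILE 24's `bgFamilyM₂R` with these readings and FILE 21's pieces `gOp ⊗ 1`, `dPiecesM₂`, `(ΔG) ⊗ 1`).  §2 ★★
`uniform_layer_fullGM₂R`: FILE 21's twelve uniform `U ≡ 1` letters plus the shift-defect row letter for an ARBITRARY forward coefficient field with rows `≤ a` and one-step oscillation `≤ aθ`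
(FILE 15 ★★ at a common rate).  §3 ★★★ `ne2PlusOperator_fullGM₂_v1G_of_entry2`, ★★★ `ne2PlusOperator_fullGM₂_v1G : NE2PlusOperator c₃₅ (fgInstanceV1G …) (fgFamilyV1G …)` at
`γ = 1∕(8(d+1))`, `d ≥ 1`, `L` odd `≥ 3`, and `_dim4`.

HOW.  FILE 24 §3 at the realised family: the fifteen letters by FILE 26 (torus discharges: commuting bond shifts, `C_π = 2(d+1)(L^m − 1)`-step-connected King fibres, block-translation law
`pr_V∘(shift′)^{L^m} = shift∘pr_V`, `η = L^{−k} = L^m·η′ ≤ min(1, θ)`, `C_πη′ ≤ 2(d+1)θ`, window `r₀ = (2(2+d)(5+2d))⁻¹`), the shift-defect row letter by §2 on the coarse forward coefficients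
(rows and oscillation = letters 2 and 13 of the bundle).

HONEST FRAMING.  MODEL-LEVEL in the species (unit-scale C² reading of (3.35)–(3.36), `𝔤 ↦ 𝔄` with coordinates `e`, block means = linearised (C3), `U ≡ 1` parallel transports inside
`V′₁`), GENUINE in the propagator; `V′₂`, `F′_{1,k}` beyond `V′₁` not included; NE2⁺ as printed NOT PRINTED, not claimed; count-neutral; N15 NOT discharged; one finite torus at fixed ε — NOT
ℝ⁴, NOT infinite volume, NOT OS, NOT a mass gap, NOT Clay.
-/

noncomputable section

open scoped BigOperators
open Finset

namespace Summit.QuantumFields.YangMills.BalabanUVNodes.N15.BackgroundLayer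

open Literature.MathematicalPhysics.QuantumFieldTheory.Balaban1983to89
open Literature.MathematicalPhysics.QuantumFieldTheory.Balaban1983to89.B11SectG (BlockNorm HasMaj RowSum)
open Literature.MathematicalPhysics.QuantumFieldTheory.Balaban1983to89.T4EtaRate (PairedInstance NE2PlusOperator rateFactor)
open Literature.MathematicalPhysics.QuantumFieldTheory.Balaban1983to89.T4EtaRateDefect (idef idef_apply rateWeight)
open Literature.MathematicalPhysics.QuantumFieldTheory.Balaban1983to89.T4EtaRateCoeffDefect (pull pull_apply diagK diagK_nonneg)
open Literature.MathematicalPhysics.QuantumFieldTheory.Balaban1983to89.B5Prop11Plancherel (Tor fine unitVec)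
open Literature.MathematicalPhysics.QuantumFieldTheory.Balaban1983to89.B5SiteBridgeP12 (MP)
open Literature.MathematicalPhysics.QuantumFieldTheory.Balaban1983to89.B6UnitTorusCarrier (unitTorusGeo triangle254_unitTorusGeo rowSum_unitTorusGeo unitTorusGeo_dist_nonneg
  unitTorusGeo_len)
open Literature.MathematicalPhysics.QuantumFieldTheory.King1986.Torus (blockOf tdistT tdistT_nonneg tdistT_self)
open Summit.QuantumFields.YangMills.BalabanUVNodes.N15.MatrixSpecies (mmulOp liftMap liftBlk liftEquiv liftEquiv_apply liftEquiv_symm_apply basisConst basisConst_nonneg)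
open Summit.QuantumFields.YangMills.BalabanUVNodes.N15.TwoGrid (gOp symbOp sT sTinv sD sLap paramsOf hasMaj_rate_mono hasMaj_twoGridDefect_div TGIndex TGIndex.Mn)
open Summit.QuantumFields.YangMills.BalabanUVNodes.N15.VectorPiece (blkFine kingPrV blkFine_comp_kingPrV bshiftEquiv bshiftEquiv_apply bshiftEquiv_symm_apply bshiftV bshiftV_apply
  tensorId tensorId_apply hasMaj_tensorId idef_tensorId kingPrV_bshiftEquiv_pow fibre_conn_kingPrV bshiftEquiv_comm inv_pow_le_rpow)

variable {d : ℕ} {L : ℕ} [NeZero L]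

/-! ## §1 The coefficient readings and the realised gauge-dressed family -/

section Family

variable (d) (𝔄 : Type) [NormedRing 𝔄] [NormedAlgebra ℝ 𝔄] [CompleteSpace 𝔄] (ι : Type) [Fintype ι] [DecidableEq ι] (e : 𝔄 ≃L[ℝ] (ι → ℝ))

/-- THE FINE COEFFICIENT READING: `A′ ↦ (c′, a′)`, the coefficients of `V′₁` (g2 V1a) at the derived triple `v1fieldsOfGauge s′ η′ A′ = (A′, A′∘s′⁻¹, ∇′*A′)`.
[cite: Balaban1985BackgroundPropagators, (3.52) p.400 (shape)] -/
def v1cfgF {X' J : Type} [Fintype J] (s' : J → X' ≃ X') (η' : ℝ) (A' : J → X' → 𝔄) : (X' → Matrix ι ι ℝ) × (J ⊕ J → X' → Matrix ι ι ℝ) :=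
  (v1coefC e η' (v1fieldsOfGauge 𝔄 J s' η' A'), v1coefA e η' (v1fieldsOfGauge 𝔄 J s' η' A'))

/-- THE COARSE COEFFICIENT READING: `A′ ↦ (c, a)` at the derived triple OF THE BLOCK-MEAN FIELD `Ā = gavgM π A′` with the coarse shifts and spacing.
[cite: Balaban1985BackgroundPropagators, (3.52) p.400 (shape); King1986, p.664 (pairing convention)] -/
def v1cfgC {X X' J : Type} [Fintype J] [Fintype X'] [DecidableEq X] (π : X' → X) (s : J → X ≃ X) (η : ℝ) (A' : J → X' → 𝔄) :
    (X → Matrix ι ι ℝ) × (J ⊕ J → X → Matrix ι ι ℝ) :=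
  (v1coefC e η (v1fieldsOfGauge 𝔄 J s η (gavgM 𝔄 J π A')), v1coefA e η (v1fieldsOfGauge 𝔄 J s η (gavgM 𝔄 J π A')))

/-- THE REALISED PAIRED INSTANCE at `(i, ν)`: FILE 24's `bgInstanceM₂R` over the unit-torus carrier with g3's C²-letter gauge carriers `v1GaugeBg` (coarse spacing `η = L^{−k}`, fine spacing
`η′ = L^{−k}L^{−m}`, bond shifts `bshiftEquiv`) and the block-mean pairing `v1GaugePairing`. [cite: Balaban1985BackgroundPropagators, Thm 3.14 pp.426–427 (typing template); (3.35)–(3.36) p.396 (shapes)] -/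
def fgInstanceV1G (hL : Odd L ∧ 1 < L) (i : TGIndex × Fin (d + 1)) : PairedInstance :=
  bgInstanceM₂R (ι := ι) (g := unitTorusGeo L i.1.k (TGIndex.Mn d hL i.1)) (blkFine L i.1.k (TGIndex.Mn d hL i.1)) (kingPrV L i.1.k i.1.m (TGIndex.Mn d hL i.1)) i.1.m
    (v1GaugeBg 𝔄 (Fin (d + 1)) (fun μ => bshiftEquiv (TGIndex.Mn d hL i.1) (L ^ i.1.k) μ) (unitTorusGeo L i.1.k (TGIndex.Mn d hL i.1)).eta (unitTorusGeo L i.1.k (TGIndex.Mn d hL i.1)).M)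
    (v1GaugeBg 𝔄 (Fin (d + 1)) (fun μ => bshiftEquiv (TGIndex.Mn d hL i.1) (L ^ i.1.m * L ^ i.1.k) μ)
      ((unitTorusGeo L i.1.k (TGIndex.Mn d hL i.1)).eta * ((unitTorusGeo L i.1.k (TGIndex.Mn d hL i.1)).L ^ i.1.m)⁻¹) (unitTorusGeo L i.1.k (TGIndex.Mn d hL i.1)).M)
    (v1GaugePairing 𝔄 (Fin (d + 1)) ι (g := unitTorusGeo L i.1.k (TGIndex.Mn d hL i.1)) (blkFine L i.1.k (TGIndex.Mn d hL i.1)) (kingPrV L i.1.k i.1.m (TGIndex.Mn d hL i.1)) (fun μ => bshiftEquiv (TGIndex.Mn d hL i.1) (L ^ i.1.k) μ)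
      (fun μ => bshiftEquiv (TGIndex.Mn d hL i.1) (L ^ i.1.m * L ^ i.1.k) μ) i.1.m (Nat.cast_ne_zero.mpr (NeZero.ne L)))

omit [CompleteSpace 𝔄] [DecidableEq ι] in
/-- It IS g3's `v1GaugeInstance` on the torus family of record. [folklore] -/
theorem fgInstanceV1G_eq (hL : Odd L ∧ 1 < L) (i : TGIndex × Fin (d + 1)) :
    fgInstanceV1G d 𝔄 ι hL i = v1GaugeInstance 𝔄 (Fin (d + 1)) ι (g := unitTorusGeo L i.1.k (TGIndex.Mn d hL i.1)) (blkFine L i.1.k (TGIndex.Mn d hL i.1))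
      (kingPrV L i.1.k i.1.m (TGIndex.Mn d hL i.1)) (fun μ => bshiftEquiv (TGIndex.Mn d hL i.1) (L ^ i.1.k) μ) (fun μ => bshiftEquiv (TGIndex.Mn d hL i.1) (L ^ i.1.m * L ^ i.1.k) μ) i.1.m
      (Nat.cast_ne_zero.mpr (NeZero.ne L)) := rfl

/-- THE REALISED GAUGE-DRESSED TWO-SIDED BY-PARTS KERNEL FAMILY at `(i, ν)`: FILE 24's `bgFamilyM₂R` with the readings `v1cfgF` (fine) ∕ `v1cfgC` (coarse, at the block mean), pieces
`G = gOp ⊗ 1_ι`, `dPiecesM₂` (forward AND backward), `D₃ = (ΔG) ⊗ 1_ι` at both spacings — all four (3.42) entries CONSTRUCTED, entry 2 BY PARTS, Bałaban's OWN `V′₁(A)`.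
[cite: Balaban1985BackgroundPropagators, (3.42) p.397 + (3.52) p.400 (shapes)] -/
def fgFamilyV1G (hL : Odd L ∧ 1 < L) (b : ℝ) (i : TGIndex × Fin (d + 1)) : B9.KernelFamily (fgInstanceV1G d 𝔄 ι hL i).gc (fgInstanceV1G d 𝔄 ι hL i).Bf :=
  bgFamilyM₂R (ι := ι) (g := unitTorusGeo L i.1.k (TGIndex.Mn d hL i.1)) (blkFine L i.1.k (TGIndex.Mn d hL i.1)) (kingPrV L i.1.k i.1.m (TGIndex.Mn d hL i.1)) i.1.m
    (v1GaugeBg 𝔄 (Fin (d + 1)) (fun μ => bshiftEquiv (TGIndex.Mn d hL i.1) (L ^ i.1.k) μ) (unitTorusGeo L i.1.k (TGIndex.Mn d hL i.1)).eta (unitTorusGeo L i.1.k (TGIndex.Mn d hL i.1)).M)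
    (v1GaugeBg 𝔄 (Fin (d + 1)) (fun μ => bshiftEquiv (TGIndex.Mn d hL i.1) (L ^ i.1.m * L ^ i.1.k) μ)
      ((unitTorusGeo L i.1.k (TGIndex.Mn d hL i.1)).eta * ((unitTorusGeo L i.1.k (TGIndex.Mn d hL i.1)).L ^ i.1.m)⁻¹) (unitTorusGeo L i.1.k (TGIndex.Mn d hL i.1)).M)
    (v1GaugePairing 𝔄 (Fin (d + 1)) ι (g := unitTorusGeo L i.1.k (TGIndex.Mn d hL i.1)) (blkFine L i.1.k (TGIndex.Mn d hL i.1)) (kingPrV L i.1.k i.1.m (TGIndex.Mn d hL i.1)) (fun μ => bshiftEquiv (TGIndex.Mn d hL i.1) (L ^ i.1.k) μ)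
      (fun μ => bshiftEquiv (TGIndex.Mn d hL i.1) (L ^ i.1.m * L ^ i.1.k) μ) i.1.m (Nat.cast_ne_zero.mpr (NeZero.ne L)))
    (v1cfgF 𝔄 ι e (fun μ => bshiftEquiv (TGIndex.Mn d hL i.1) (L ^ i.1.m * L ^ i.1.k) μ)
      ((unitTorusGeo L i.1.k (TGIndex.Mn d hL i.1)).eta * ((unitTorusGeo L i.1.k (TGIndex.Mn d hL i.1)).L ^ i.1.m)⁻¹))
    (v1cfgC 𝔄 ι e (kingPrV L i.1.k i.1.m (TGIndex.Mn d hL i.1)) (fun μ => bshiftEquiv (TGIndex.Mn d hL i.1) (L ^ i.1.k) μ) (unitTorusGeo L i.1.k (TGIndex.Mn d hL i.1)).eta)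
    (fun μ => bshiftEquiv (TGIndex.Mn d hL i.1) (L ^ i.1.k) μ) (fun μ => bshiftEquiv (TGIndex.Mn d hL i.1) (L ^ i.1.m * L ^ i.1.k) μ) ((L ^ i.1.k : ℕ) : ℝ) ((L ^ i.1.m * L ^ i.1.k : ℕ) : ℝ) i.2
    (tensorId ι (gOp (TGIndex.Mn d hL i.1) (L ^ i.1.k) b))
    (tensorId ι (symbOp (TGIndex.Mn d hL i.1) (L ^ i.1.k) (sLap (TGIndex.Mn d hL i.1) (L ^ i.1.k) ((L ^ i.1.k : ℕ) : ℝ)) ∘ₗ gOp (TGIndex.Mn d hL i.1) (L ^ i.1.k) b))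
    (dPiecesM₂ d ι (TGIndex.Mn d hL i.1) (L ^ i.1.k) b)
    (tensorId ι (gOp (TGIndex.Mn d hL i.1) (L ^ i.1.m * L ^ i.1.k) b))
    (tensorId ι (symbOp (TGIndex.Mn d hL i.1) (L ^ i.1.m * L ^ i.1.k) (sLap (TGIndex.Mn d hL i.1) (L ^ i.1.m * L ^ i.1.k) ((L ^ i.1.m * L ^ i.1.k : ℕ) : ℝ)) ∘ₗ
      gOp (TGIndex.Mn d hL i.1) (L ^ i.1.m * L ^ i.1.k) b))
    (dPiecesM₂ d ι (TGIndex.Mn d hL i.1) (L ^ i.1.m * L ^ i.1.k) b)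

end Family

/-! ## §2 The uniform `U ≡ 1` letters with a GENERIC shift-defect row letter -/

section Letters

variable (d) (ι : Type) [Fintype ι] [DecidableEq ι] [Nonempty ι]

omit [DecidableEq ι] in
/-- ★★ **THE UNIFORM `U ≡ 1` LETTERS OF FILE 21 WITH THE SHIFT-DEFECT ROW LETTER FOR AN ARBITRARY FORWARD COEFFICIENT FIELD** (rows `≤ a`, one-step oscillation `≤ aθ_i`): FILE 21
`uniform_layer_fullGM₂` (twelve conjuncts verbatim) at a rate below FILE 15's, and FILE 15 ★★ `hasMaj_shiftDefect_fullGM` at `C_a = M_{Â_μ∘e_μ⁻¹}` (FILE 12 `hasMaj_mmulOp_translate` ∕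
`hasMaj_mmulOp_sub_translate` ∕ `pull_comp_mmulOp_translate`). [cite: Balaban1984PropagatorsI, Prop. 1.2 (1.110)–(1.111) p.35; Balaban1984PropagatorsII, (2.156) p.250; King1986, p.664] -/
theorem uniform_layer_fullGM₂R (hLodd : Odd L) (hL2 : 2 ≤ L) (hL : Odd L ∧ 1 < L) {b : ℝ} (hb : 0 < b) {γ : ℝ} (hγ0 : 0 < γ) (hγ1 : γ ≤ 1 / 16)
    {δ₂ B₂ : ℝ} (hδ₂ : 0 < δ₂) (hB₂ : 0 ≤ B₂) :
    ∃ δ β m₀ cT mT : ℝ, 0 < δ ∧ δ ≤ δ₂ ∧ 0 < β ∧ 0 < m₀ ∧ B₂ ≤ m₀ ∧ 0 < cT ∧ 0 < mT ∧ ∀ i : TGIndex × Fin (d + 1),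
      HasMaj (BlockNorm.ofBlocks (unitTorusGeo L i.1.k (TGIndex.Mn d hL i.1)) (liftBlk (blkFine L i.1.k (TGIndex.Mn d hL i.1)) ι))
          (BlockNorm.ofBlocks (unitTorusGeo L i.1.k (TGIndex.Mn d hL i.1)) (liftBlk (blkFine L i.1.k (TGIndex.Mn d hL i.1)) ι))
          (tensorId ι (gOp (TGIndex.Mn d hL i.1) (L ^ i.1.k) b)) (fun y y' => β * Real.exp (-(δ * (unitTorusGeo L i.1.k (TGIndex.Mn d hL i.1)).dist y y'))) ∧
      (∀ μ, HasMaj (BlockNorm.ofBlocks (unitTorusGeo L i.1.k (TGIndex.Mn d hL i.1)) (liftBlk (blkFine L i.1.k (TGIndex.Mn d hL i.1)) ι))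
          (BlockNorm.ofBlocks (unitTorusGeo L i.1.k (TGIndex.Mn d hL i.1)) (liftBlk (blkFine L i.1.k (TGIndex.Mn d hL i.1)) ι))
          (dPiecesM₂ d ι (TGIndex.Mn d hL i.1) (L ^ i.1.k) b μ) (fun y y' => β * Real.exp (-(δ * (unitTorusGeo L i.1.k (TGIndex.Mn d hL i.1)).dist y y')))) ∧
      HasMaj (BlockNorm.ofBlocks (unitTorusGeo L i.1.k (TGIndex.Mn d hL i.1)) (liftBlk (blkFine L i.1.k (TGIndex.Mn d hL i.1) ∘ kingPrV L i.1.k i.1.m (TGIndex.Mn d hL i.1)) ι))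
          (BlockNorm.ofBlocks (unitTorusGeo L i.1.k (TGIndex.Mn d hL i.1)) (liftBlk (blkFine L i.1.k (TGIndex.Mn d hL i.1) ∘ kingPrV L i.1.k i.1.m (TGIndex.Mn d hL i.1)) ι))
          (tensorId ι (gOp (TGIndex.Mn d hL i.1) (L ^ i.1.m * L ^ i.1.k) b)) (fun y y' => β * Real.exp (-(δ * (unitTorusGeo L i.1.k (TGIndex.Mn d hL i.1)).dist y y'))) ∧
      (∀ μ, HasMaj (BlockNorm.ofBlocks (unitTorusGeo L i.1.k (TGIndex.Mn d hL i.1)) (liftBlk (blkFine L i.1.k (TGIndex.Mn d hL i.1) ∘ kingPrV L i.1.k i.1.m (TGIndex.Mn d hL i.1)) ι))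
          (BlockNorm.ofBlocks (unitTorusGeo L i.1.k (TGIndex.Mn d hL i.1)) (liftBlk (blkFine L i.1.k (TGIndex.Mn d hL i.1) ∘ kingPrV L i.1.k i.1.m (TGIndex.Mn d hL i.1)) ι))
          (dPiecesM₂ d ι (TGIndex.Mn d hL i.1) (L ^ i.1.m * L ^ i.1.k) b μ) (fun y y' => β * Real.exp (-(δ * (unitTorusGeo L i.1.k (TGIndex.Mn d hL i.1)).dist y y')))) ∧
      HasMaj (BlockNorm.ofBlocks (unitTorusGeo L i.1.k (TGIndex.Mn d hL i.1)) (liftBlk (blkFine L i.1.k (TGIndex.Mn d hL i.1) ∘ kingPrV L i.1.k i.1.m (TGIndex.Mn d hL i.1)) ι))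
          (BlockNorm.ofBlocks (unitTorusGeo L i.1.k (TGIndex.Mn d hL i.1)) (liftBlk (blkFine L i.1.k (TGIndex.Mn d hL i.1) ∘ kingPrV L i.1.k i.1.m (TGIndex.Mn d hL i.1)) ι))
          (tensorId ι (symbOp (TGIndex.Mn d hL i.1) (L ^ i.1.m * L ^ i.1.k) (sLap (TGIndex.Mn d hL i.1) (L ^ i.1.m * L ^ i.1.k) ((L ^ i.1.m * L ^ i.1.k : ℕ) : ℝ)) ∘ₗ
            gOp (TGIndex.Mn d hL i.1) (L ^ i.1.m * L ^ i.1.k) b)) (fun y y' => β * Real.exp (-(δ * (unitTorusGeo L i.1.k (TGIndex.Mn d hL i.1)).dist y y'))) ∧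
      HasMaj (BlockNorm.ofBlocks (unitTorusGeo L i.1.k (TGIndex.Mn d hL i.1)) (liftBlk (blkFine L i.1.k (TGIndex.Mn d hL i.1)) ι))
          (BlockNorm.ofBlocks (unitTorusGeo L i.1.k (TGIndex.Mn d hL i.1)) (liftBlk (blkFine L i.1.k (TGIndex.Mn d hL i.1) ∘ kingPrV L i.1.k i.1.m (TGIndex.Mn d hL i.1)) ι))
          (idef (pull (liftMap (kingPrV L i.1.k i.1.m (TGIndex.Mn d hL i.1)) ι)) (pull (liftMap (kingPrV L i.1.k i.1.m (TGIndex.Mn d hL i.1)) ι))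
            (tensorId ι (gOp (TGIndex.Mn d hL i.1) (L ^ i.1.m * L ^ i.1.k) b)) (tensorId ι (gOp (TGIndex.Mn d hL i.1) (L ^ i.1.k) b)))
          (fun y y' => m₀ * ((L : ℝ) ^ i.1.k) ^ (-γ) * Real.exp (-(δ * (unitTorusGeo L i.1.k (TGIndex.Mn d hL i.1)).dist y y'))) ∧
      (∀ μ, HasMaj (BlockNorm.ofBlocks (unitTorusGeo L i.1.k (TGIndex.Mn d hL i.1)) (liftBlk (blkFine L i.1.k (TGIndex.Mn d hL i.1)) ι))
          (BlockNorm.ofBlocks (unitTorusGeo L i.1.k (TGIndex.Mn d hL i.1)) (liftBlk (blkFine L i.1.k (TGIndex.Mn d hL i.1) ∘ kingPrV L i.1.k i.1.m (TGIndex.Mn d hL i.1)) ι))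
          (idef (pull (liftMap (kingPrV L i.1.k i.1.m (TGIndex.Mn d hL i.1)) ι)) (pull (liftMap (kingPrV L i.1.k i.1.m (TGIndex.Mn d hL i.1)) ι))
            (dPiecesM₂ d ι (TGIndex.Mn d hL i.1) (L ^ i.1.m * L ^ i.1.k) b μ) (dPiecesM₂ d ι (TGIndex.Mn d hL i.1) (L ^ i.1.k) b μ))
          (fun y y' => m₀ * ((L : ℝ) ^ i.1.k) ^ (-γ) * Real.exp (-(δ * (unitTorusGeo L i.1.k (TGIndex.Mn d hL i.1)).dist y y')))) ∧
      HasMaj (BlockNorm.ofBlocks (unitTorusGeo L i.1.k (TGIndex.Mn d hL i.1)) (liftBlk (blkFine L i.1.k (TGIndex.Mn d hL i.1)) ι))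
          (BlockNorm.ofBlocks (unitTorusGeo L i.1.k (TGIndex.Mn d hL i.1)) (liftBlk (blkFine L i.1.k (TGIndex.Mn d hL i.1) ∘ kingPrV L i.1.k i.1.m (TGIndex.Mn d hL i.1)) ι))
          (idef (pull (liftMap (kingPrV L i.1.k i.1.m (TGIndex.Mn d hL i.1)) ι)) (pull (liftMap (kingPrV L i.1.k i.1.m (TGIndex.Mn d hL i.1)) ι))
            (tensorId ι (symbOp (TGIndex.Mn d hL i.1) (L ^ i.1.m * L ^ i.1.k) (sLap (TGIndex.Mn d hL i.1) (L ^ i.1.m * L ^ i.1.k) ((L ^ i.1.m * L ^ i.1.k : ℕ) : ℝ)) ∘ₗ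
              gOp (TGIndex.Mn d hL i.1) (L ^ i.1.m * L ^ i.1.k) b))
            (tensorId ι (symbOp (TGIndex.Mn d hL i.1) (L ^ i.1.k) (sLap (TGIndex.Mn d hL i.1) (L ^ i.1.k) ((L ^ i.1.k : ℕ) : ℝ)) ∘ₗ gOp (TGIndex.Mn d hL i.1) (L ^ i.1.k) b)))
          (fun y y' => m₀ * ((L : ℝ) ^ i.1.k) ^ (-γ) * Real.exp (-(δ * (unitTorusGeo L i.1.k (TGIndex.Mn d hL i.1)).dist y y'))) ∧
      (∀ ν, HasMaj (BlockNorm.ofBlocks (unitTorusGeo L i.1.k (TGIndex.Mn d hL i.1)) (liftBlk (blkFine L i.1.k (TGIndex.Mn d hL i.1)) ι))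
          (BlockNorm.ofBlocks (unitTorusGeo L i.1.k (TGIndex.Mn d hL i.1)) (liftBlk (blkFine L i.1.k (TGIndex.Mn d hL i.1)) ι))
          (tensorId ι (gOp (TGIndex.Mn d hL i.1) (L ^ i.1.k) b) ∘ₗ fgradAdj ((L ^ i.1.k : ℕ) : ℝ) (liftEquiv (bshiftEquiv (TGIndex.Mn d hL i.1) (L ^ i.1.k) ν) ι))
          (fun y y' => β * Real.exp (-(δ * (unitTorusGeo L i.1.k (TGIndex.Mn d hL i.1)).dist y y')))) ∧
      (∀ ν, HasMaj (BlockNorm.ofBlocks (unitTorusGeo L i.1.k (TGIndex.Mn d hL i.1)) (liftBlk (blkFine L i.1.k (TGIndex.Mn d hL i.1) ∘ kingPrV L i.1.k i.1.m (TGIndex.Mn d hL i.1)) ι))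
          (BlockNorm.ofBlocks (unitTorusGeo L i.1.k (TGIndex.Mn d hL i.1)) (liftBlk (blkFine L i.1.k (TGIndex.Mn d hL i.1) ∘ kingPrV L i.1.k i.1.m (TGIndex.Mn d hL i.1)) ι))
          (tensorId ι (gOp (TGIndex.Mn d hL i.1) (L ^ i.1.m * L ^ i.1.k) b) ∘ₗ
            fgradAdj ((L ^ i.1.m * L ^ i.1.k : ℕ) : ℝ) (liftEquiv (bshiftEquiv (TGIndex.Mn d hL i.1) (L ^ i.1.m * L ^ i.1.k) ν) ι))
          (fun y y' => β * Real.exp (-(δ * (unitTorusGeo L i.1.k (TGIndex.Mn d hL i.1)).dist y y')))) ∧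
      (∀ μ, HasMaj (BlockNorm.ofBlocks (unitTorusGeo L i.1.k (TGIndex.Mn d hL i.1)) (liftBlk (blkFine L i.1.k (TGIndex.Mn d hL i.1)) ι))
          (BlockNorm.ofBlocks (unitTorusGeo L i.1.k (TGIndex.Mn d hL i.1)) (liftBlk (blkFine L i.1.k (TGIndex.Mn d hL i.1)) ι))
          (pull ⇑(liftEquiv (bshiftEquiv (TGIndex.Mn d hL i.1) (L ^ i.1.k) μ) ι)) (fun y y' => cT * Real.exp (-(δ * (unitTorusGeo L i.1.k (TGIndex.Mn d hL i.1)).dist y y')))) ∧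
      (∀ μ, HasMaj (BlockNorm.ofBlocks (unitTorusGeo L i.1.k (TGIndex.Mn d hL i.1)) (liftBlk (blkFine L i.1.k (TGIndex.Mn d hL i.1) ∘ kingPrV L i.1.k i.1.m (TGIndex.Mn d hL i.1)) ι))
          (BlockNorm.ofBlocks (unitTorusGeo L i.1.k (TGIndex.Mn d hL i.1)) (liftBlk (blkFine L i.1.k (TGIndex.Mn d hL i.1) ∘ kingPrV L i.1.k i.1.m (TGIndex.Mn d hL i.1)) ι))
          (pull ⇑(liftEquiv (bshiftEquiv (TGIndex.Mn d hL i.1) (L ^ i.1.m * L ^ i.1.k) μ) ι))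
          (fun y y' => cT * Real.exp (-(δ * (unitTorusGeo L i.1.k (TGIndex.Mn d hL i.1)).dist y y')))) ∧
      (∀ (A : Fin (d + 1) ⊕ Fin (d + 1) → Tor (fine (L ^ i.1.k) (TGIndex.Mn d hL i.1)) × Fin (d + 1) → Matrix ι ι ℝ) (a : ℝ), 0 ≤ a →
          (∀ μ x i', ∑ j, |A (Sum.inl μ) x i' j| ≤ a) →
          (∀ μ x i', ∑ j, |A (Sum.inl μ) x i' j - A (Sum.inl μ) ((bshiftEquiv (TGIndex.Mn d hL i.1) (L ^ i.1.k) μ).symm x) i' j| ≤ a * ((L : ℝ) ^ i.1.k) ^ (-γ)) →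
        ∀ μ, HasMaj (BlockNorm.ofBlocks (unitTorusGeo L i.1.k (TGIndex.Mn d hL i.1)) (liftBlk (liftBlk (blkFine L i.1.k (TGIndex.Mn d hL i.1)) ι) (Fin (d + 1))))
          (BlockNorm.ofBlocks (unitTorusGeo L i.1.k (TGIndex.Mn d hL i.1)) (liftBlk (blkFine L i.1.k (TGIndex.Mn d hL i.1) ∘ kingPrV L i.1.k i.1.m (TGIndex.Mn d hL i.1)) ι))
          (idef (pull (liftMap (kingPrV L i.1.k i.1.m (TGIndex.Mn d hL i.1)) ι)) (pull (liftMap (kingPrV L i.1.k i.1.m (TGIndex.Mn d hL i.1)) ι))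
              (pull ⇑(liftEquiv (bshiftEquiv (TGIndex.Mn d hL i.1) (L ^ i.1.m * L ^ i.1.k) μ) ι)) (pull ⇑(liftEquiv (bshiftEquiv (TGIndex.Mn d hL i.1) (L ^ i.1.k) μ) ι)) ∘ₗ
            (mmulOp (A (Sum.inl μ) ∘ ⇑(bshiftEquiv (TGIndex.Mn d hL i.1) (L ^ i.1.k) μ).symm) ∘ₗ
              sumJ fun ν => tensorId ι (gOp (TGIndex.Mn d hL i.1) (L ^ i.1.k) b) ∘ₗ fgradAdj ((L ^ i.1.k : ℕ) : ℝ) (liftEquiv (bshiftEquiv (TGIndex.Mn d hL i.1) (L ^ i.1.k) ν) ι)))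
          (fun y y' => mT * a * ((L : ℝ) ^ i.1.k) ^ (-γ) * Real.exp (-(δ * (unitTorusGeo L i.1.k (TGIndex.Mn d hL i.1)).dist y y')))) := by
  have hγlt1 : γ < 1 := by linarith
  have hLr1 : (1 : ℝ) ≤ (L : ℝ) := by exact_mod_cast (show 1 ≤ L by omega)
  obtain ⟨δ₄, C₄, hδ₄, hC₄, H4⟩ := hasMaj_shiftDefect_fullGM (d := d) ι hLodd hL2 hb hγ0.le hγlt1
  obtain ⟨δ, β, m₀, cT, mT, hδ, hδδ, hβ, hm₀, hBm, hcT, -, H⟩ := uniform_layer_fullGM₂ d ι hLodd hL2 hL hb hγ0 hγ1 0 (lt_min hδ₂ hδ₄) hB₂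
  refine ⟨δ, β, m₀, cT, 2 * C₄, hδ, hδδ.trans (min_le_left _ _), hβ, hm₀, hBm, hcT, by positivity, fun i => ?_⟩
  have hδ₄' : δ ≤ δ₄ := hδδ.trans (min_le_right _ _)
  obtain ⟨hG, hD, hG', hD', hD₃', hDG, hDD, hDD₃, hS, hS', hSh, hSh', -⟩ := H i
  refine ⟨hG, hD, hG', hD', hD₃', hDG, hDD, hDD₃, hS, hS', hSh, hSh', fun A a ha hrows hosc μ => ?_⟩
  obtain ⟨⟨mT', k, hk, m⟩, ν⟩ := i
  simp only at hrows hosc ⊢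
  have hxθ : 0 ≤ ((L : ℝ) ^ k) ^ (-γ) := Real.rpow_nonneg (by positivity) _
  have haθ : 0 ≤ a * ((L : ℝ) ^ k) ^ (-γ) := mul_nonneg ha hxθ
  have hcast : ((L ^ k : ℕ) : ℝ) = (L : ℝ) ^ k := by push_cast; ring
  have hd0 : ∀ y y' : Tor (TGIndex.Mn d hL ⟨mT', k, hk, m⟩), 0 ≤ tdistT (TGIndex.Mn d hL ⟨mT', k, hk, m⟩) y y' := fun y y' => tdistT_nonneg _ _ _
  have hCa : HasMaj (BlockNorm.ofBlocks (unitTorusGeo L k (TGIndex.Mn d hL ⟨mT', k, hk, m⟩)) (liftBlk (blkFine L k (TGIndex.Mn d hL ⟨mT', k, hk, m⟩)) ι))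
      (BlockNorm.ofBlocks (unitTorusGeo L k (TGIndex.Mn d hL ⟨mT', k, hk, m⟩)) (liftBlk (blkFine L k (TGIndex.Mn d hL ⟨mT', k, hk, m⟩)) ι))
      (mmulOp (A (Sum.inl μ) ∘ ⇑(bshiftEquiv (TGIndex.Mn d hL ⟨mT', k, hk, m⟩) (L ^ k) μ).symm)) (diagK fun _ => a) :=
    hasMaj_mmulOp_translate (g := unitTorusGeo L k (TGIndex.Mn d hL ⟨mT', k, hk, m⟩)) (blkFine L k (TGIndex.Mn d hL ⟨mT', k, hk, m⟩))
      (τ := fun μ => bshiftEquiv (TGIndex.Mn d hL ⟨mT', k, hk, m⟩) (L ^ k) μ) (A := fun μ => A (Sum.inl μ)) ha hrows μ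
  have hOsc : HasMaj (BlockNorm.ofBlocks (unitTorusGeo L k (TGIndex.Mn d hL ⟨mT', k, hk, m⟩)) (liftBlk (blkFine L k (TGIndex.Mn d hL ⟨mT', k, hk, m⟩)) ι))
      (BlockNorm.ofBlocks (unitTorusGeo L k (TGIndex.Mn d hL ⟨mT', k, hk, m⟩)) (liftBlk (blkFine L k (TGIndex.Mn d hL ⟨mT', k, hk, m⟩)) ι))
      (mmulOp (A (Sum.inl μ)) - mmulOp (A (Sum.inl μ) ∘ ⇑(bshiftEquiv (TGIndex.Mn d hL ⟨mT', k, hk, m⟩) (L ^ k) μ).symm)) (diagK fun _ => a * ((L : ℝ) ^ k) ^ (-γ)) :=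
    hasMaj_mmulOp_sub_translate (g := unitTorusGeo L k (TGIndex.Mn d hL ⟨mT', k, hk, m⟩)) (blkFine L k (TGIndex.Mn d hL ⟨mT', k, hk, m⟩))
      (τ := fun μ => bshiftEquiv (TGIndex.Mn d hL ⟨mT', k, hk, m⟩) (L ^ k) μ) (A := fun μ => A (Sum.inl μ)) μ haθ (hosc μ)
  have hCaS : pull ⇑(liftEquiv (bshiftEquiv (TGIndex.Mn d hL ⟨mT', k, hk, m⟩) (L ^ k) μ) ι) ∘ₗ
      mmulOp (A (Sum.inl μ) ∘ ⇑(bshiftEquiv (TGIndex.Mn d hL ⟨mT', k, hk, m⟩) (L ^ k) μ).symm) =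
      mmulOp (A (Sum.inl μ)) ∘ₗ pull ⇑(liftEquiv (bshiftEquiv (TGIndex.Mn d hL ⟨mT', k, hk, m⟩) (L ^ k) μ) ι) := pull_comp_mmulOp_translate _ _
  have key := H4 mT' k m hk hL μ _ _ a (a * ((L : ℝ) ^ k) ^ (-γ)) ha haθ hCaS hCa hOsc
  refine key.mono fun y y' => ?_
  rw [hcast]
  have hE : Real.exp (-(δ₄ * tdistT (TGIndex.Mn d hL ⟨mT', k, hk, m⟩) y y')) ≤ Real.exp (-(δ * tdistT (TGIndex.Mn d hL ⟨mT', k, hk, m⟩) y y')) :=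
    Real.exp_le_exp.mpr (by nlinarith [hd0 y y'])
  have heq : C₄ * (a * ((L : ℝ) ^ k) ^ (-γ) + a * ((L : ℝ) ^ k) ^ (-γ)) = 2 * C₄ * a * ((L : ℝ) ^ k) ^ (-γ) := by ring
  calc C₄ * (a * ((L : ℝ) ^ k) ^ (-γ) + a * ((L : ℝ) ^ k) ^ (-γ)) * Real.exp (-(δ₄ * tdistT (TGIndex.Mn d hL ⟨mT', k, hk, m⟩) y y'))
      ≤ C₄ * (a * ((L : ℝ) ^ k) ^ (-γ) + a * ((L : ℝ) ^ k) ^ (-γ)) * Real.exp (-(δ * tdistT (TGIndex.Mn d hL ⟨mT', k, hk, m⟩) y y')) :=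
        mul_le_mul_of_nonneg_left hE (by positivity)
    _ = 2 * C₄ * a * ((L : ℝ) ^ k) ^ (-γ) * Real.exp (-(δ * tdistT (TGIndex.Mn d hL ⟨mT', k, hk, m⟩) y y')) := by rw [heq]

end Letters

/-! ## §3 ★★★ `NE2PlusOperator` BY NAME for `gOp ⊗ 1_𝔤` dressed by Bałaban's `V′₁(A)` of a LIVE gauge field -/

section Node

variable (d) (𝔄 : Type) [NormedRing 𝔄] [NormedAlgebra ℝ 𝔄] [CompleteSpace 𝔄] (ι : Type) [Fintype ι] [DecidableEq ι] [Nonempty ι] (e : 𝔄 ≃L[ℝ] (ι → ℝ))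

/-- ★★★ **`T4EtaRate.NE2PlusOperator` BY NAME FOR BAŁABAN's FULL `U ≡ 1` PROPAGATOR ⊗ 1_𝔤 DRESSED BY HIS OWN `V′₁(A)` OF A LIVE GAUGE FIELD (fine coefficients from `A′`, coarse from the block
mean `Ā`), MODULO ONLY THE `U ≡ 1` ENTRY-2 η-DEFECT** — FILE 24 ★★★ `ne2PlusOperator_twoSided_of_letters` at the realised family: letters by FILE 26 ★★★ `twoSidedLetters_of_meanGauge` (torus
discharges: `bshiftEquiv_comm`, `fibre_conn_kingPrV`, `kingPrV_bshiftEquiv_pow`, `η = L^{−k} = L^m η′`, `C_πη′ ≤ 2(d+1)θ`, window `r₀ = (2(1+(d+1))(3+2(d+1)))⁻¹`, scale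
`κ′ = 14e(1+(d+1))²(3+2(d+1))(κ_e+1)`), the shift-defect row letter by §2 on the coarse forward coefficients, every other `U ≡ 1` input from §2.
[cite: Balaban1985BackgroundPropagators, Thm 3.1 p.397 (quantifier template); (3.35)–(3.36) p.396, (3.42) p.397, (3.52) p.400, (3.63)–(3.65) p.402 (shapes, mechanism); King1986, p.664] -/
theorem ne2PlusOperator_fullGM₂_v1G_of_entry2 (hLodd : Odd L) (hL2 : 2 ≤ L) (hL : Odd L ∧ 1 < L) {b : ℝ} (hb : 0 < b) (c35 : ℝ) (hc35 : 0 < c35)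
    {γ : ℝ} (hγ0 : 0 < γ) (hγ1 : γ ≤ 1 / 16) {B₂ δ₂ : ℝ} (hB₂ : 0 ≤ B₂) (hδ₂ : 0 < δ₂)
    (h2 : ∀ (i : TGIndex) (ν : Fin (d + 1)),
      HasMaj (BlockNorm.ofBlocks (unitTorusGeo L i.k (TGIndex.Mn d hL i)) (blkFine L i.k (TGIndex.Mn d hL i)))
        (BlockNorm.ofBlocks (unitTorusGeo L i.k (TGIndex.Mn d hL i)) (blkFine L i.k (TGIndex.Mn d hL i) ∘ kingPrV L i.k i.m (TGIndex.Mn d hL i)))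
        (idef (pull (kingPrV L i.k i.m (TGIndex.Mn d hL i))) (pull (kingPrV L i.k i.m (TGIndex.Mn d hL i)))
          (gOp (TGIndex.Mn d hL i) (L ^ i.m * L ^ i.k) b ∘ₗ fgradAdj ((L ^ i.m * L ^ i.k : ℕ) : ℝ) (bshiftEquiv (TGIndex.Mn d hL i) (L ^ i.m * L ^ i.k) ν))
          (gOp (TGIndex.Mn d hL i) (L ^ i.k) b ∘ₗ fgradAdj ((L ^ i.k : ℕ) : ℝ) (bshiftEquiv (TGIndex.Mn d hL i) (L ^ i.k) ν)))
        (fun y y' => B₂ * ((L : ℝ) ^ i.k) ^ (-γ) * Real.exp (-(δ₂ * tdistT (TGIndex.Mn d hL i) y y')))) :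
    NE2PlusOperator c35 (fgInstanceV1G d 𝔄 ι hL) (fgFamilyV1G d 𝔄 ι e hL b) := by
  obtain ⟨δ, β, m₀, cT, mT, hδ, hδδ₂, hβ, hm₀, hBm, hcT, hmT, H⟩ := uniform_layer_fullGM₂R d ι hLodd hL2 hL hb hγ0 hγ1 hδ₂ hB₂
  have hL0 : L ≠ 0 := by omega
  have hL1 : 1 ≤ L := by omega
  have hLr : (0 : ℝ) < (L : ℝ) := by exact_mod_cast (show 0 < L by omega)
  have hLr1 : (1 : ℝ) ≤ (L : ℝ) := by exact_mod_cast hL1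
  have hγle1 : γ ≤ 1 := by linarith
  have hσ : 0 < δ / 12 := by positivity
  have hdJ : (Fintype.card (Fin (d + 1)) : ℝ) = (d : ℝ) + 1 := by rw [Fintype.card_fin]; push_cast; ring
  have hdJ0 : (0 : ℝ) ≤ Fintype.card (Fin (d + 1)) := Nat.cast_nonneg _
  have hDS : ∀ (i : TGIndex × Fin (d + 1)) (ν : Fin (d + 1)),
      HasMaj (BlockNorm.ofBlocks (unitTorusGeo L i.1.k (TGIndex.Mn d hL i.1)) (liftBlk (blkFine L i.1.k (TGIndex.Mn d hL i.1)) ι)) (BlockNorm.ofBlocks (unitTorusGeo L i.1.k (TGIndex.Mn d hL i.1)) (liftBlk (blkFine L i.1.k (TGIndex.Mn d hL i.1) ∘ kingPrV L i.1.k i.1.m (TGIndex.Mn d hL i.1)) ι))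
        (idef (pull (liftMap (kingPrV L i.1.k i.1.m (TGIndex.Mn d hL i.1)) ι)) (pull (liftMap (kingPrV L i.1.k i.1.m (TGIndex.Mn d hL i.1)) ι))
          (tensorId ι (gOp (TGIndex.Mn d hL i.1) (L ^ i.1.m * L ^ i.1.k) b) ∘ₗ fgradAdj ((L ^ i.1.m * L ^ i.1.k : ℕ) : ℝ) (liftEquiv (bshiftEquiv (TGIndex.Mn d hL i.1) (L ^ i.1.m * L ^ i.1.k) ν) ι))
          (tensorId ι (gOp (TGIndex.Mn d hL i.1) (L ^ i.1.k) b) ∘ₗ fgradAdj ((L ^ i.1.k : ℕ) : ℝ) (liftEquiv (bshiftEquiv (TGIndex.Mn d hL i.1) (L ^ i.1.k) ν) ι)))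
        (fun y y' => m₀ * ((L : ℝ) ^ i.1.k) ^ (-γ) * Real.exp (-(δ * (unitTorusGeo L i.1.k (TGIndex.Mn d hL i.1)).dist y y'))) := fun i ν => by
    rw [idef_comp_fgradAdj_liftEquiv]
    exact hasMaj_tensorId ι (fun _ _ => mul_nonneg (mul_nonneg hm₀.le (Real.rpow_nonneg (pow_nonneg hLr.le _) _)) (Real.exp_nonneg _))
      ((h2 i.1 ν).mono fun y y' => le_rate hB₂ hBm (one_le_pow₀ hLr1) le_rfl hδδ₂ (tdistT_nonneg _ _ _))
  -- the constants of the gauge letters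
  set C₀ : ℝ := 2 * ((d : ℝ) + 1) with hC₀
  have hC₀0 : 0 ≤ C₀ := by positivity
  set κ' : ℝ := 14 * Real.exp 1 * (1 + Fintype.card (Fin (d + 1))) * ((1 + Fintype.card (Fin (d + 1))) * (3 + C₀)) * (basisConst e + 1) with hκ'def
  have hκe := basisConst_nonneg e
  have hκ'pos : 0 < κ' := by positivity
  set r₀ : ℝ := (2 * ((1 + Fintype.card (Fin (d + 1))) * (3 + C₀)))⁻¹ with hr₀def
  have hden : 0 < 2 * ((1 + Fintype.card (Fin (d + 1))) * (3 + C₀)) := by positivity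
  have hr₀ : 0 < r₀ := inv_pos.2 hden
  -- the fifteen letters at every index, for every regular gauge field in the window
  have hLT : ∀ (i : TGIndex × Fin (d + 1)) (A' : Fin (d + 1) → Tor (fine (L ^ i.1.m * L ^ i.1.k) (TGIndex.Mn d hL i.1)) × Fin (d + 1) → 𝔄) (α₀ : ℝ),
      (v1GaugeBg 𝔄 (Fin (d + 1)) (fun μ => bshiftEquiv (TGIndex.Mn d hL i.1) (L ^ i.1.m * L ^ i.1.k) μ) ((unitTorusGeo L i.1.k (TGIndex.Mn d hL i.1)).eta * ((unitTorusGeo L i.1.k (TGIndex.Mn d hL i.1)).L ^ i.1.m)⁻¹) (unitTorusGeo L i.1.k (TGIndex.Mn d hL i.1)).M).Reg335 c35 α₀ A' → 0 < α₀ → 1 ≤ (unitTorusGeo L i.1.k (TGIndex.Mn d hL i.1)).M →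
      c35 * (unitTorusGeo L i.1.k (TGIndex.Mn d hL i.1)).M * α₀ ≤ r₀ →
      TwoSidedLetters (Fin (d + 1)) ι (kingPrV L i.1.k i.1.m (TGIndex.Mn d hL i.1)) (fun μ => bshiftEquiv (TGIndex.Mn d hL i.1) (L ^ i.1.k) μ) (fun μ => bshiftEquiv (TGIndex.Mn d hL i.1) (L ^ i.1.m * L ^ i.1.k) μ) ((L ^ i.1.k : ℕ) : ℝ)
        ((L ^ i.1.m * L ^ i.1.k : ℕ) : ℝ) (κ' * (c35 * (unitTorusGeo L i.1.k (TGIndex.Mn d hL i.1)).M * α₀)) (((L : ℝ) ^ i.1.k) ^ (-γ))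
        (v1cfgF 𝔄 ι e (fun μ => bshiftEquiv (TGIndex.Mn d hL i.1) (L ^ i.1.m * L ^ i.1.k) μ) ((unitTorusGeo L i.1.k (TGIndex.Mn d hL i.1)).eta * ((unitTorusGeo L i.1.k (TGIndex.Mn d hL i.1)).L ^ i.1.m)⁻¹) A')
        (v1cfgC 𝔄 ι e (kingPrV L i.1.k i.1.m (TGIndex.Mn d hL i.1)) (fun μ => bshiftEquiv (TGIndex.Mn d hL i.1) (L ^ i.1.k) μ) (unitTorusGeo L i.1.k (TGIndex.Mn d hL i.1)).eta A') := by
    intro i A' α₀ hreg hα₀ hM hwin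
    obtain ⟨h1, h2', h3⟩ := hreg
    have hMeq : (unitTorusGeo L i.1.k (TGIndex.Mn d hL i.1)).M = 1 := rfl
    have hηc : (unitTorusGeo L i.1.k (TGIndex.Mn d hL i.1)).eta = ((L : ℝ) ^ i.1.k)⁻¹ := rfl
    have hηf : (unitTorusGeo L i.1.k (TGIndex.Mn d hL i.1)).eta * ((unitTorusGeo L i.1.k (TGIndex.Mn d hL i.1)).L ^ i.1.m)⁻¹ = ((L : ℝ) ^ i.1.k)⁻¹ * ((L : ℝ) ^ i.1.m)⁻¹ := rfl
    have hLk : (0 : ℝ) < (L : ℝ) ^ i.1.k := pow_pos hLr _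
    have hLm : (0 : ℝ) < (L : ℝ) ^ i.1.m := pow_pos hLr _
    have hη' : 0 < (unitTorusGeo L i.1.k (TGIndex.Mn d hL i.1)).eta * ((unitTorusGeo L i.1.k (TGIndex.Mn d hL i.1)).L ^ i.1.m)⁻¹ := by rw [hηf]; positivity
    have hη : 0 < (unitTorusGeo L i.1.k (TGIndex.Mn d hL i.1)).eta := by rw [hηc]; positivity
    have hη1 : (unitTorusGeo L i.1.k (TGIndex.Mn d hL i.1)).eta ≤ 1 := by rw [hηc]; exact inv_le_one_of_one_le₀ (one_le_pow₀ hLr1)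
    have hηθ : (unitTorusGeo L i.1.k (TGIndex.Mn d hL i.1)).eta ≤ ((L : ℝ) ^ i.1.k) ^ (-γ) := by rw [hηc]; exact inv_pow_le_rpow hL1 i.1.k hγle1
    have hθ0 : 0 ≤ ((L : ℝ) ^ i.1.k) ^ (-γ) := Real.rpow_nonneg hLk.le _
    have hN : (unitTorusGeo L i.1.k (TGIndex.Mn d hL i.1)).eta = ((L ^ i.1.m : ℕ) : ℝ) * ((unitTorusGeo L i.1.k (TGIndex.Mn d hL i.1)).eta * ((unitTorusGeo L i.1.k (TGIndex.Mn d hL i.1)).L ^ i.1.m)⁻¹) := by rw [hηf, hηc]; push_cast; field_simp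
    have hn : (unitTorusGeo L i.1.k (TGIndex.Mn d hL i.1)).eta⁻¹ = ((L ^ i.1.k : ℕ) : ℝ) := by rw [hηc, inv_inv]; push_cast; ring
    have hn' : ((unitTorusGeo L i.1.k (TGIndex.Mn d hL i.1)).eta * ((unitTorusGeo L i.1.k (TGIndex.Mn d hL i.1)).L ^ i.1.m)⁻¹)⁻¹ = ((L ^ i.1.m * L ^ i.1.k : ℕ) : ℝ) := by rw [hηf, mul_inv, inv_inv, inv_inv]; push_cast; ring
    -- `C_π·η′ ≤ 2(d+1)·θ`
    have hCθ : ((2 * ((d + 1) * (L ^ i.1.m - 1)) : ℕ) : ℝ) * ((unitTorusGeo L i.1.k (TGIndex.Mn d hL i.1)).eta * ((unitTorusGeo L i.1.k (TGIndex.Mn d hL i.1)).L ^ i.1.m)⁻¹) ≤ C₀ * ((L : ℝ) ^ i.1.k) ^ (-γ) := by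
      have hθ' : ((L : ℝ) ^ i.1.k)⁻¹ ≤ ((L : ℝ) ^ i.1.k) ^ (-γ) := inv_pow_le_rpow hL1 i.1.k hγle1
      have hsub : (((L ^ i.1.m - 1 : ℕ)) : ℝ) ≤ (L : ℝ) ^ i.1.m := by
        have h1 : 1 ≤ L ^ i.1.m := Nat.one_le_pow _ _ (by omega)
        rw [Nat.cast_sub h1]; push_cast; linarith
      have hcast : ((2 * ((d + 1) * (L ^ i.1.m - 1)) : ℕ) : ℝ) = 2 * ((d : ℝ) + 1) * (((L ^ i.1.m - 1 : ℕ)) : ℝ) := by push_cast; ring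
      rw [hηf, hcast, hC₀]
      calc 2 * ((d : ℝ) + 1) * (((L ^ i.1.m - 1 : ℕ)) : ℝ) * (((L : ℝ) ^ i.1.k)⁻¹ * ((L : ℝ) ^ i.1.m)⁻¹)
          ≤ 2 * ((d : ℝ) + 1) * (L : ℝ) ^ i.1.m * (((L : ℝ) ^ i.1.k)⁻¹ * ((L : ℝ) ^ i.1.m)⁻¹) :=
            mul_le_mul_of_nonneg_right (mul_le_mul_of_nonneg_left hsub (by positivity)) (by positivity)
        _ = 2 * ((d : ℝ) + 1) * ((L : ℝ) ^ i.1.k)⁻¹ := by field_simp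
        _ ≤ 2 * ((d : ℝ) + 1) * ((L : ℝ) ^ i.1.k) ^ (-γ) := mul_le_mul_of_nonneg_left hθ' (by positivity)
    -- the window
    have hr0 : 0 ≤ c35 * (unitTorusGeo L i.1.k (TGIndex.Mn d hL i.1)).M * α₀ := by rw [hMeq]; positivity
    have hr2 : 2 * ((1 + Fintype.card (Fin (d + 1))) * ((3 + C₀) * (c35 * (unitTorusGeo L i.1.k (TGIndex.Mn d hL i.1)).M * α₀))) ≤ 1 := by
      calc 2 * ((1 + Fintype.card (Fin (d + 1))) * ((3 + C₀) * (c35 * (unitTorusGeo L i.1.k (TGIndex.Mn d hL i.1)).M * α₀))) = (2 * ((1 + Fintype.card (Fin (d + 1))) * (3 + C₀))) * (c35 * (unitTorusGeo L i.1.k (TGIndex.Mn d hL i.1)).M * α₀) := by ring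
        _ ≤ (2 * ((1 + Fintype.card (Fin (d + 1))) * (3 + C₀))) * r₀ := mul_le_mul_of_nonneg_left hwin hden.le
        _ = 1 := by rw [hr₀def]; exact mul_inv_cancel₀ hden.ne'
    have key := twoSidedLetters_of_meanGauge e (ι := ι) (fun μ κ x => bshiftEquiv_comm (TGIndex.Mn d hL i.1) (L ^ i.1.m * L ^ i.1.k) μ κ x)
      (fun f β hf => fibre_conn_kingPrV L i.1.k i.1.m (TGIndex.Mn d hL i.1) f β hf) (fun μ x' => kingPrV_bshiftEquiv_pow L i.1.k i.1.m (TGIndex.Mn d hL i.1) μ x') hη' hN hη hη1 hηθ hC₀0 hCθ hr0 hr2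
      h1 h2' h3
    rw [hn, hn'] at key
    refine key.mono ?_ hθ0
    have hT : 0 ≤ 14 * Real.exp 1 * (1 + Fintype.card (Fin (d + 1))) * ((1 + Fintype.card (Fin (d + 1))) * (3 + C₀)) * (c35 * (unitTorusGeo L i.1.k (TGIndex.Mn d hL i.1)).M * α₀) := by positivity
    calc 14 * Real.exp 1 * (1 + Fintype.card (Fin (d + 1))) * basisConst e * ((1 + Fintype.card (Fin (d + 1))) * ((3 + C₀) * (c35 * (unitTorusGeo L i.1.k (TGIndex.Mn d hL i.1)).M * α₀)))
        = 14 * Real.exp 1 * (1 + Fintype.card (Fin (d + 1))) * ((1 + Fintype.card (Fin (d + 1))) * (3 + C₀)) * (c35 * (unitTorusGeo L i.1.k (TGIndex.Mn d hL i.1)).M * α₀) * basisConst e := by ring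
      _ ≤ 14 * Real.exp 1 * (1 + Fintype.card (Fin (d + 1))) * ((1 + Fintype.card (Fin (d + 1))) * (3 + C₀)) * (c35 * (unitTorusGeo L i.1.k (TGIndex.Mn d hL i.1)).M * α₀) * (basisConst e + 1) :=
          mul_le_mul_of_nonneg_left (by linarith) hT
      _ = κ' * (c35 * (unitTorusGeo L i.1.k (TGIndex.Mn d hL i.1)).M * α₀) := by rw [hκ'def]; ring
  refine ne2PlusOperator_twoSided_of_letters (I := TGIndex × Fin (d + 1)) (J := Fin (d + 1)) (ι := ι) (fun i => (unitTorusGeo L i.1.k (TGIndex.Mn d hL i.1)))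
    (fun i => Tor (fine (L ^ i.1.k) (TGIndex.Mn d hL i.1)) × Fin (d + 1)) (fun i => Tor (fine (L ^ i.1.m * L ^ i.1.k) (TGIndex.Mn d hL i.1)) × Fin (d + 1))
    (fun i => blkFine L i.1.k (TGIndex.Mn d hL i.1)) (fun i => kingPrV L i.1.k i.1.m (TGIndex.Mn d hL i.1)) (fun i μ => bshiftEquiv (TGIndex.Mn d hL i.1) (L ^ i.1.k) μ) (fun i μ => bshiftEquiv (TGIndex.Mn d hL i.1) (L ^ i.1.m * L ^ i.1.k) μ)
    (fun i => ((L ^ i.1.k : ℕ) : ℝ)) (fun i => ((L ^ i.1.m * L ^ i.1.k : ℕ) : ℝ)) (fun i => i.1.m)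
    (fun i => v1GaugeBg 𝔄 (Fin (d + 1)) (fun μ => bshiftEquiv (TGIndex.Mn d hL i.1) (L ^ i.1.k) μ) (unitTorusGeo L i.1.k (TGIndex.Mn d hL i.1)).eta (unitTorusGeo L i.1.k (TGIndex.Mn d hL i.1)).M)
    (fun i => v1GaugeBg 𝔄 (Fin (d + 1)) (fun μ => bshiftEquiv (TGIndex.Mn d hL i.1) (L ^ i.1.m * L ^ i.1.k) μ) ((unitTorusGeo L i.1.k (TGIndex.Mn d hL i.1)).eta * ((unitTorusGeo L i.1.k (TGIndex.Mn d hL i.1)).L ^ i.1.m)⁻¹) (unitTorusGeo L i.1.k (TGIndex.Mn d hL i.1)).M)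
    (fun i => v1GaugePairing 𝔄 (Fin (d + 1)) ι (g := (unitTorusGeo L i.1.k (TGIndex.Mn d hL i.1))) (blkFine L i.1.k (TGIndex.Mn d hL i.1)) (kingPrV L i.1.k i.1.m (TGIndex.Mn d hL i.1)) (fun μ => bshiftEquiv (TGIndex.Mn d hL i.1) (L ^ i.1.k) μ)
      (fun μ => bshiftEquiv (TGIndex.Mn d hL i.1) (L ^ i.1.m * L ^ i.1.k) μ) i.1.m (Nat.cast_ne_zero.mpr (NeZero.ne L)))
    (fun i => v1cfgF 𝔄 ι e (fun μ => bshiftEquiv (TGIndex.Mn d hL i.1) (L ^ i.1.m * L ^ i.1.k) μ) ((unitTorusGeo L i.1.k (TGIndex.Mn d hL i.1)).eta * ((unitTorusGeo L i.1.k (TGIndex.Mn d hL i.1)).L ^ i.1.m)⁻¹))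
    (fun i => v1cfgC 𝔄 ι e (kingPrV L i.1.k i.1.m (TGIndex.Mn d hL i.1)) (fun μ => bshiftEquiv (TGIndex.Mn d hL i.1) (L ^ i.1.k) μ) (unitTorusGeo L i.1.k (TGIndex.Mn d hL i.1)).eta)
    (fun i => ((L : ℝ) ^ i.1.k) ^ (-γ)) (fun i => i.2)
    (fun i => tensorId ι (gOp (TGIndex.Mn d hL i.1) (L ^ i.1.k) b))
    (fun i => tensorId ι (symbOp (TGIndex.Mn d hL i.1) (L ^ i.1.k) (sLap (TGIndex.Mn d hL i.1) (L ^ i.1.k) ((L ^ i.1.k : ℕ) : ℝ)) ∘ₗ gOp (TGIndex.Mn d hL i.1) (L ^ i.1.k) b))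
    (fun i => dPiecesM₂ d ι (TGIndex.Mn d hL i.1) (L ^ i.1.k) b)
    (fun i => tensorId ι (gOp (TGIndex.Mn d hL i.1) (L ^ i.1.m * L ^ i.1.k) b))
    (fun i => tensorId ι (symbOp (TGIndex.Mn d hL i.1) (L ^ i.1.m * L ^ i.1.k) (sLap (TGIndex.Mn d hL i.1) (L ^ i.1.m * L ^ i.1.k) ((L ^ i.1.m * L ^ i.1.k : ℕ) : ℝ)) ∘ₗ gOp (TGIndex.Mn d hL i.1) (L ^ i.1.m * L ^ i.1.k) b))
    (fun i => dPiecesM₂ d ι (TGIndex.Mn d hL i.1) (L ^ i.1.m * L ^ i.1.k) b)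
    c35 κ' r₀ hc35 hκ'pos hr₀ (fun i => triangle254_unitTorusGeo L i.1.k (TGIndex.Mn d hL i.1)) (fun i a c => tdistT_nonneg _ _ _) (fun i y => tdistT_self _ y) hσ.le
    (B4Sect5Proof.latticeConst_nonneg (d + 1) hσ.le) (fun i => rowSum_unitTorusGeo L i.1.k (TGIndex.Mn d hL i.1) hσ)
    (fun i => inv_pos.mpr (pow_pos hLr _)) (fun i => hLr) (fun i y => (unitTorusGeo_len L i.1.k (TGIndex.Mn d hL i.1) hL0 y).symm.le)
    (by linarith) hβ.le hm₀.le hγ0 (fun i => Real.rpow_nonneg (pow_nonneg hLr.le _) _) (fun i y => le_rfl) hcT.le hmT.le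
    (fun i => (H i).1) (fun i => (H i).2.1) (fun i => (H i).2.2.1) (fun i => (H i).2.2.2.1) (fun i => (H i).2.2.2.2.1) (fun i => (H i).2.2.2.2.2.1)
    (fun i => (H i).2.2.2.2.2.2.1) (fun i => (H i).2.2.2.2.2.2.2.1) (fun i => (H i).2.2.2.2.2.2.2.2.1) (fun i => (H i).2.2.2.2.2.2.2.2.2.1)
    (fun i ν => hDS i ν) (fun i => (H i).2.2.2.2.2.2.2.2.2.2.1) (fun i => (H i).2.2.2.2.2.2.2.2.2.2.2.1)
    (fun i U α₀ hreg hα₀ hM hwin => hLT i U α₀ hreg hα₀ hM hwin) (fun i U α₀ hreg hα₀ hM hwin μ => ?_)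
  -- the shift-defect row letter on the coarse forward coefficients: §2's generic conjunct with the letters 2 and 13 of the bundle
  obtain ⟨-, hA, -, -, -, -, -, -, -, -, -, -, hosc, -, -⟩ := hLT i U α₀ hreg hα₀ hM hwin
  exact (H i).2.2.2.2.2.2.2.2.2.2.2.2 (v1cfgC 𝔄 ι e (kingPrV L i.1.k i.1.m (TGIndex.Mn d hL i.1)) (fun μ => bshiftEquiv (TGIndex.Mn d hL i.1) (L ^ i.1.k) μ) (unitTorusGeo L i.1.k (TGIndex.Mn d hL i.1)).eta U).2 _
    (mul_nonneg hκ'pos.le (mul_nonneg (mul_nonneg hc35.le (zero_le_one.trans hM)) hα₀.le)) (fun μ x i' => hA (Sum.inl μ) x i') hosc μ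

/-- ★★★ **`T4EtaRate.NE2PlusOperator` BY NAME, NO DISPLAYED BINDER: Bałaban's FULL `U ≡ 1` Landau-gauge propagator ⊗ 1_𝔤 on the torus family of record, dressed by HIS OWN FIRST-ORDER SPECIES
`V′₁(A)` (3.52) OF A LIVE GAUGE FIELD `A′` — `c = ad_{∇*A} + Σ_μ[F′(ad A⁺_μ) + F′(ad A⁻_μ)]`, `a^±_μ = ad A^±_μ ± ηF′(ad A^±_μ)` in coordinates `e : 𝔄 ≃ ℝ^ι`, fine coefficients from `A′`, COARSE
coefficients from the BLOCK MEAN `Ā = gavgM pr_V A′`, BOTH bond orientations, all four (3.42) entries CONSTRUCTED (entry 2 by parts), rate exponent `γ = 1∕(8(d+1))` (`d ≥ 1`)** — fed with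
dag-n15-a's ENTRY 2 (part 71).  Every input is a tree theorem; NO (3.44) mixed letter.  MODEL-LEVEL in the species (unit-scale C² reading of (3.35)–(3.36), `U ≡ 1` transports inside `V′₁`,
block-mean transport), GENUINE in the propagator. [cite: Balaban1985BackgroundPropagators, Thm 3.1 p.397 (quantifier template); (3.35)–(3.36) p.396, (3.42) p.397, (3.52) p.400, (3.63)–(3.65) p.402 (shapes, mechanism); Balaban1984PropagatorsI, Prop. 1.2 (1.110)–(1.111) p.35; Balaban1984PropagatorsII, (2.156) p.250; King1986, p.664] -/
theorem ne2PlusOperator_fullGM₂_v1G (hd1 : 1 ≤ d) (hLodd : Odd L) (hL2 : 2 ≤ L) (hL : Odd L ∧ 1 < L) {b : ℝ} (hb : 0 < b) (c35 : ℝ) (hc35 : 0 < c35) :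
    NE2PlusOperator c35 (fgInstanceV1G d 𝔄 ι hL) (fgFamilyV1G d 𝔄 ι e hL b) := by
  obtain ⟨δ₂, B₂, hδ₂, hB₂, H2⟩ := hasMaj_twoGridDefect_div (d := d) hLodd hL2 hb
  have hd1' : (1 : ℝ) ≤ (d : ℝ) := by exact_mod_cast hd1
  have hγ0 : 0 < 1 / (8 * ((d : ℝ) + 1)) := by positivity
  have hγ1 : 1 / (8 * ((d : ℝ) + 1)) ≤ 1 / 16 := one_div_le_one_div_of_le (by norm_num) (by nlinarith)
  refine ne2PlusOperator_fullGM₂_v1G_of_entry2 d 𝔄 ι e hLodd hL2 hL hb c35 hc35 hγ0 hγ1 hB₂.le hδ₂ fun i ν => ?_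
  have h := H2 i.mT i.k i.m i.one_le hL ν
  rw [← symbOp_sTinv_sub_one_eq, ← symbOp_sTinv_sub_one_eq, blkFine_comp_kingPrV]
  refine h.mono fun y y' => le_of_eq ?_
  rw [show ((L ^ i.k : ℕ) : ℝ) = (L : ℝ) ^ i.k by push_cast; ring]
  exact rfl

/-- The four-dimensional gauge-dressed instance (`d + 1 = 4`, `γ = 1∕32`). [cite: Balaban1985BackgroundPropagators, Thm 3.1 p.397 (quantifier template)] -/
theorem ne2PlusOperator_fullGM₂_v1G_dim4 (hLodd : Odd L) (hL2 : 2 ≤ L) (hL : Odd L ∧ 1 < L) {b : ℝ} (hb : 0 < b) (c35 : ℝ) (hc35 : 0 < c35) :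
    NE2PlusOperator c35 (fgInstanceV1G 3 𝔄 ι hL) (fgFamilyV1G 3 𝔄 ι e hL b) :=
  ne2PlusOperator_fullGM₂_v1G 3 𝔄 ι e (by norm_num) hLodd hL2 hL hb c35 hc35

end Node

end Summit.QuantumFields.YangMills.BalabanUVNodes.N15.BackgroundLayer

end
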